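import Summits.ResolutionOfSingularities.ResolutionOfSingularities.Theorems.HilbertSamuelEliminationSigmaMaxModificationsCorridor3WLadderForcedGameTowersDefs
import Literature.AlgebraicGeometry.Resolution.ExcellentRingsFieldProofs
import Literature.AlgebraicGeometry.Resolution.SigmaMaxEliminationInDim
import Literature.AlgebraicGeometry.Resolution.BlowupsProperProofs
import HarnessLib

/-!
# [OURS · L1 W4.2] MODULE `Corridor3WLadderForcedGameTowers` (crux chain w42, idea-1 ROUND 5 card C4 `forced-hironaka-game-iso-vertices`)
# — part 2/2: the PROVED lemmas and assemblies

PROVENANCE / SPLIT FOR THE GATE (typer res-type-012; res-L1-w42-plan-1 «W4.2 DEAL» 2026-08-27T07:34:07Z, D2 «C4 TOWER LAYER»): see part 1/2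
`…Corridor3WLadderForcedGameTowersDefs` (definitions).  This part lands the PROVED content of §§1–4 of res-L1-w42-idea-1's
`Sketch-L1-idea-1-C4.lean` (sha16 `08c84fc33d6000e7`): §1 `forcedMove_eq_shadowMoveT`, `eq_univ_of_isIsoAdmissible`,
`not_won_of_isIsoAdmissible`, `forcedGameTerminates_of_spivakovsky` (the forced game terminates, FROM the hypothesis `Prop`
`PositionalWin d` — Literature, DEAL D4 — BY NAME); §2 `genPoints_nonneg`, `isIsoAdmissible_of_pairs`; §4 `isoVertexTowersImpossible_of`
(T2 from `IsoVertexChainImpossible`, P2, P1), `isoQuadraticTowerTerminates_of_vertex_translation` (the kernel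
`IdeasL1Idea2R4.IsoQuadraticTowerTerminates p 3` from T2 and T3), `isoQuadraticTowerTerminates_of_forcedGame` — statements and proofs
BYTE-IDENTICAL to the sketch except the two proofs touched by the RETYPINGS of part 1/2 (DEAL D2 ← res-D-pv-010 FINDING #2):
`isoVertexTowersImpossible_of` now derives `u_k ∈ 𝔪` from `(u_k) = 𝔪_{S_k}` and propagates EXCELLENCE from the first stage along
the tower (blow-ups of locally noetherian schemes are proper, `IsBlowup.isProper`, hence locally of finite type;
`Scheme.IsExcellent.of_locallyOfFiniteType`) before invoking the retyped P1; `isoQuadraticTowerTerminates_of_vertex_translation`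
supplies the first stage's excellence from the maximal origin (finite type over a field: `Scheme.isExcellent_of_locallyOfFiniteType
Stacks07QW_field_holds`).  CONDITIONAL content credits nothing toward the crux: T2 holds modulo {`PositionalWin 3`
(printed [Spivakovsky1983], hypothesis by name, Literature D4), `ForcedGameTerminates 3 → IsoVertexChainImpossible` and `PairConditionOfAlgIsolated` (DEAL D5,
res-D-pv-010), `AlgIsolatedOfIsolated` (P1, M+, not dealt)}, and the kernel modulo T2 and the residual OPEN core T3
`IsoTranslationTowersImpossible p`.  Helper VOCABULARY/lemmas (counted 0; card C4 not yet triaged).  OURS; NOT statements of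
[CossartJannsenSaito2020], [CossartPiltant2019], [Spivakovsky1983] nor of the manuscript [Hironaka2017]; AI typing, weaker than
expert review.
-/

set_option linter.dupNamespace false
set_option autoImplicit false

noncomputable section

open Polynomial Finset
open scoped BigOperators

namespace Summit.ResolutionOfSingularities.ResolutionOfSingularities.Cruxes.SigmaMaxModifications.IdeasL1C4

open Summit.ResolutionOfSingularities.ResolutionOfSingularities.Theorems.CampaignW42
open Summit.ResolutionOfSingularities.ResolutionOfSingularities.Theses.HilbertSamuelElimination
open Summit.ResolutionOfSingularities.ResolutionOfSingularities.Theorems.SigmaMaxModificationsCorridor3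
open Summit.ResolutionOfSingularities.ResolutionOfSingularities.Theorems.SigmaMaxModificationsCorridor3.Moving
open Summit.ResolutionOfSingularities.ResolutionOfSingularities.Theorems.SigmaMaxModificationsCorridor3.ShadowM
open Summit.ResolutionOfSingularities.ResolutionOfSingularities.Cruxes.SigmaMaxModifications.IdeasL1Idea2R4
open Literature.AlgebraicGeometry.Resolution.CossartPiltant
open Literature.Combinatorics.HironakaPolyhedraGame

/-! ## §1. The forced game terminates (from Spivakovsky's theorem, taken as a hypothesis by name) -/

section Game

variable {d : ℕ}

/-- For `d = 3` the forced move `σ_{univ,i}` is the tree's `ShadowM.shadowMoveT univ ∅ i`. [folklore] -/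
theorem forcedMove_eq_shadowMoveT (i : Fin 3) : forcedMove i = shadowMoveT Finset.univ ∅ i := by
  funext a j
  simp [forcedMove, gameMove, shadowMoveT]

/-- At an iso-admissible position the only nonempty permissible `Γ` is `univ`. [folklore] -/
theorem eq_univ_of_isIsoAdmissible {A : Finset (Fin d → ℚ)} (hA : IsIsoAdmissible A) {Γ : Finset (Fin d)}
    (hne : Γ.Nonempty) (hperm : IsPermissible A Γ) : Γ = Finset.univ := by
  by_contra hΓ
  exact hA.2.2 Γ hne hΓ hperm

/-- An iso-admissible position is not won. [folklore] -/
theorem not_won_of_isIsoAdmissible {A : Finset (Fin d → ℚ)} (hA : IsIsoAdmissible A) : ¬ Won A := by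
  rintro ⟨a, ha, hle⟩
  exact absurd (hA.2.1 a ha) (not_lt.mpr hle)

/-- **`CL` from Spivakovsky** (OURS lemma; the printed theorem enters as the hypothesis `PositionalWin d` BY NAME —
Literature `…HironakaPolyhedraGame.Spivakovsky1983`, DEAL D4; = idea-1's `SpivakovskyWinningStrategy d`): a forced
play is consistent with the winning strategy, hence finite. [cite: Spivakovsky1983, Theorem p. 420 (pointer)] -/
theorem forcedGameTerminates_of_spivakovsky (h : PositionalWin d) : ForcedGameTerminates d := by
  classical
  intro A i hstep hadm
  obtain ⟨σ, hσ, hwin⟩ := h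
  -- B's answers: the forced index on `univ`, anything inside `Γ` otherwise
  let resp : ℕ → Finset (Fin d) → Fin d := fun n Γ =>
    if hΓu : Γ = Finset.univ then i n else if hΓ : Γ.Nonempty then hΓ.choose else i n
  have hresp : ∀ n Γ, Γ.Nonempty → resp n Γ ∈ Γ := by
    intro n Γ hΓ
    by_cases hΓu : Γ = Finset.univ
    · simp [resp, hΓu]
    · simp only [resp, hΓu, hΓ, dite_true, dite_false]
      exact hΓ.choose_spec
  -- the σ-play from `A 0` IS the forced sequence
  have hplay : ∀ n, play σ resp (A 0) n = A n := by
    intro n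
    induction n with
    | zero => rfl
    | succ n ih =>
      have hσn := hσ (A n) (hadm n).1 (not_won_of_isIsoAdmissible (hadm n))
      have hu : σ (A n) = Finset.univ := eq_univ_of_isIsoAdmissible (hadm n) hσn.1 hσn.2
      have hr : resp n Finset.univ = i n := by simp [resp]
      show (play σ resp (A 0) n).image _ = A (n + 1)
      rw [ih, hstep n, hu, hr]
      rfl
  obtain ⟨l, hl⟩ := hwin (A 0) (hadm 0).1 (not_won_of_isIsoAdmissible (hadm 0)) resp hresp
  rw [hplay l] at hl
  exact not_won_of_isIsoAdmissible (hadm l) hl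
end Game

/-! ## §2. Generating points: non-negativity and the pair condition -/

section Chain

/-- Generating points have non-negative coordinates. [folklore] -/
theorem genPoints_nonneg {S : Type} [CommRing S] (u : Fin 3 → S) (h : S[X]) :
    ∀ g ∈ genPoints u h, ∀ j, (0 : ℚ) ≤ g j := by
  intro g hg j
  classical
  simp only [genPoints, Finset.mem_biUnion, Finset.mem_image] at hg
  obtain ⟨i, -, a, -, rfl⟩ := hg
  positivity

set_option maxHeartbeats 400000 in
/-- The pair condition at every pair gives iso-admissibility, granted `δ > 1`. [folklore] -/
theorem isIsoAdmissible_of_pairs {S : Type} [CommRing S] (u : Fin 3 → S) (h : S[X])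
    (hpair : ∀ a b : Fin 3, a ≠ b → ∃ g ∈ genPoints u h, g a + g b < 1)
    (hδ : ∀ g ∈ genPoints u h, (1 : ℚ) < ∑ j, g j) : IsIsoAdmissible (genPoints u h) := by
  classical
  have h01 : (0 : Fin 3) ≠ 1 := by decide
  refine ⟨⟨?_, genPoints_nonneg u h⟩, hδ, ?_⟩
  · obtain ⟨g, hg, -⟩ := hpair 0 1 h01
    exact ⟨g, hg⟩
  · intro Γ hne hΓ hperm
    -- a nonempty proper `Γ ⊆ Fin 3` misses some index `c`; pick the pair `{a, b} = univ \ {c}` ⊇ Γ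
    obtain ⟨c, hc⟩ : ∃ c, c ∉ Γ := by
      by_contra hall
      push Not at hall
      exact hΓ (Finset.eq_univ_of_forall hall)
    -- the two other indices
    obtain ⟨a, b, hab, hac, hbc⟩ : ∃ a b : Fin 3, a ≠ b ∧ a ≠ c ∧ b ≠ c := by
      fin_cases c
      · exact ⟨1, 2, by decide, by decide, by decide⟩
      · exact ⟨0, 2, by decide, by decide, by decide⟩
      · exact ⟨0, 1, by decide, by decide, by decide⟩
    obtain ⟨g, hg, hlt⟩ := hpair a b hab
    have hsub : Γ ⊆ ({a, b} : Finset (Fin 3)) := by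
      intro j hj
      have hjc : j ≠ c := fun h => hc (h ▸ hj)
      have : j = a ∨ j = b := by
        fin_cases j <;> fin_cases c <;> fin_cases a <;> fin_cases b <;> simp_all
      simpa [Finset.mem_insert, Finset.mem_singleton] using this
    have hle : ∑ j ∈ Γ, g j ≤ ∑ j ∈ ({a, b} : Finset (Fin 3)), g j :=
      Finset.sum_le_sum_of_subset_of_nonneg hsub fun j _ _ => genPoints_nonneg u h g hg j
    have hab' : ∑ j ∈ ({a, b} : Finset (Fin 3)), g j = g a + g b := Finset.sum_pair hab
    have := hperm g hg
    linarith
end Chain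

/-! ## §4. Assemblies: T2 from its three named inputs; the kernel from T2 and T3; the corollary from the forced game -/

section Assembly

open CategoryTheory AlgebraicGeometry TopologicalSpace
open Literature.AlgebraicGeometry.CossartJannsenSaito2020 Literature.AlgebraicGeometry.Resolution

universe u

/-- **Excellence propagates along a tower of blow-ups**: blow-ups of locally noetherian schemes are proper (`IsBlowup.isProper`), hence
locally of finite type, and a locally noetherian scheme locally of finite type over an excellent one is excellent
(`Scheme.IsExcellent.of_locallyOfFiniteType`). [folklore] -/
theorem isExcellent_stage (T : BlowupTower.{u}) (h0 : Scheme.IsExcellent (T.X 0)) : ∀ n, Scheme.IsExcellent (T.X n) := by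
  intro n
  induction n with
  | zero => exact h0
  | succ n ih =>
    haveI : IsLocallyNoetherian (T.X n) := T.ln n
    haveI : IsLocallyNoetherian (T.X (n + 1)) := T.ln (n + 1)
    haveI : IsProper (T.π n) := (T.isBlowup n).isProper
    exact Scheme.IsExcellent.of_locallyOfFiniteType (T.π n) ih

/-- **The first stage of a tower over a maximal origin is excellent** (finite type over a field;
`Scheme.isExcellent_of_locallyOfFiniteType Stacks07QW_field_holds`). [folklore] -/
theorem isExcellent_of_isMaximalOrigin {p N : ℕ} {ν : ℕ → ℕ} {X : Scheme.{u}} {x : X} (hO : IsMaximalOrigin p N ν X x) :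
    Scheme.IsExcellent X := by
  obtain ⟨k, _, _, f, -, hft, -⟩ := hO.exists_structure
  haveI := hft
  exact Scheme.isExcellent_of_locallyOfFiniteType Stacks07QW_field_holds f

/-- **ASSEMBLY (PROVED): the kernel from T2 and T3** (the maximal origin makes the first stage excellent). [folklore] -/
theorem isoQuadraticTowerTerminates_of_vertex_translation (p : ℕ) (h2 : IsoVertexTowersImpossible.{u})
    (h3 : IsoTranslationTowersImpossible.{u} p) : IsoQuadraticTowerTerminates.{u} p 3 := by
  intro ν T pt hO hT
  exact h2 ν T pt (isExcellent_of_isMaximalOrigin hO) hT (h3 ν T pt hO hT)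

/-- **T2 (PROVED from its three named inputs): an iso point tower with excellent first stage has no vertex-chained tail.**
Excellence is propagated to every stage (`isExcellent_stage`) and `u_k ∈ 𝔪_{S_k}` is read off `(u_k) = 𝔪_{S_k}` before the retyped
P1 is invoked at level `3` at each stage of the tail; otherwise idea-1's proof verbatim. [folklore] -/
theorem isoVertexTowersImpossible_of (hCL : IsoVertexChainImpossible) (hP2 : PairConditionOfAlgIsolated)
    (hP1 : AlgIsolatedOfIsolated.{u}) : IsoVertexTowersImpossible.{u} := by
  intro ν T pt hexc0 hT htail
  obtain ⟨n₀, S, iC, iR, u, h, iQ, φ, j₀, ψ, χ, hpres, hH, hfr, hmon, hnzd, hrel, hψ, hdeg, hcoef, -, -, -, hδ⟩ := htail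
  have hexc := isExcellent_stage T hexc0
  have hu : ∀ k i, u k i ∈ IsLocalRing.maximalIdeal (S k) := fun k i =>
    (hfr k).2 ▸ Ideal.subset_span ⟨i, rfl⟩
  have hiso := hT.2.2.2.2.1
  refine hCL S u h j₀ ψ hH hu hnzd hrel hψ hdeg hcoef fun k => ?_
  refine isIsoAdmissible_of_pairs (u k) (h k) ?_ (hδ k)
  refine hP2 (S k) (u k) (h k) (hH k) (hu k) (hmon k) ?_
  letI := T.ln (n₀ + k)
  exact hP1 (T.X (n₀ + k)) (hexc (n₀ + k)) (pt (n₀ + k)) (hiso (n₀ + k)) (S k) (u k) (h k) (φ k) (hfr k).1 (hfr k).2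
    (hH k) (hpres k).1 (hpres k).2.1 (hpres k).2.2.1 (hpres k).2.2.2 (hmon k)

/-- **COROLLARY (PROVED): the kernel from Spivakovsky's theorem (hypothesis by name), the two M-sized algebra lemmas (DEAL D5), P1, and the
residual T3.** [folklore] -/
theorem isoQuadraticTowerTerminates_of_forcedGame (p : ℕ) (hF : PositionalWin 3)
    (hT2alg : ForcedGameTerminates 3 → IsoVertexChainImpossible) (hP2 : PairConditionOfAlgIsolated)
    (hP1 : AlgIsolatedOfIsolated.{u}) (h3 : IsoTranslationTowersImpossible.{u} p) :
    IsoQuadraticTowerTerminates.{u} p 3 :=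
  isoQuadraticTowerTerminates_of_vertex_translation p
    (isoVertexTowersImpossible_of (hT2alg (forcedGameTerminates_of_spivakovsky hF)) hP2 hP1) h3
end Assembly

end Summit.ResolutionOfSingularities.ResolutionOfSingularities.Cruxes.SigmaMaxModifications.IdeasL1C4
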